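import Literature.Geometry.Kaehler.TangentConeWeakLimit
import Literature.Geometry.Kaehler.HolomorphicChainBlowUpMassLimit
import Literature.Geometry.GeometricMeasureTheory.RectifiableDataRestrict
import Literature.Geometry.GeometricMeasureTheory.MassComplete
import HarnessLib

/-!
# The defect currents `D_r − [C(T,b)] ⌞ 𝐁(0,1)` of the blow-ups of a holomorphic chain

Let `T` be a holomorphic `p`-chain (`p = q + 1`) on an open `Ω ⊆ V`, `b ∈ Ω`, `D_r` its blow-ups on
the unit ball and `C` a holomorphic `p`-chain on `V` (the tangent-cone chain `C(T,b)` of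
`TangentConeChain.lean` when `|T|` has pure dimension `p`). The named fact
`Literature.Geometry.Kaehler.King1971_tangentCone` is phrased with the currents
`D_r − C.toCurrentIn (unitBall V)` on the unit ball. This file records, in exactly that vocabulary,
what the weak form of King's theorem (`TangentConeWeakLimit.lean`) and the Lelong bounds give —
the hypotheses side of Federer's passage from weak to flat convergence [Federer1969, 4.3.16 via
4.2.17]:

* `HolomorphicChain.toCurrentIn_unitBall_eq_comp`, `…toCurrentIn_unitBall_apply` — `[C] ⌞ 𝐁(0,1)`
  is the restriction of `[C]`: `[C]⌞𝐁(0,1) (ψ) = [C](ψ̃)`; `…toCurrentIn_unitBall_eq_inter` — it is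
  the current of integration over `carrier C ∩ 𝐁(0,1)` with admissible data
  (`isRectifiableData_carrier_inter_unitBall`), so it is locally rectifiable, of finite mass
  (`mass_toCurrentIn_unitBall_ne_top`, Lelong bound) and a cycle
  (`boundary_toCurrentIn_unitBall_eq_zero`);
* `HolomorphicChain.tendsto_blowUp_sub_toCurrentIn_apply` — **weak King in the fact's
  vocabulary**: `(D_r − [C(T,b)]⌞𝐁(0,1))(ψ) → 0` as `r → 0⁺` for every `ψ ∈ 𝓓^{2p}(𝐁(0,1))`;
  `exists_conic_tendsto_blowUp_sub_toCurrentIn_apply` — unconditional form;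
* `HolomorphicChain.boundary_blowUp_sub_toCurrentIn_eq_zero` — the defect currents are cycles on
  the unit ball; `exists_mass_blowUp_sub_toCurrentIn_le` — they have uniformly bounded mass for
  small `r`;
* `HolomorphicChain.mass_toCurrentIn_tangentConeChain_le` — **the mass of the tangent cone on the
  unit ball is at most the density**: `𝐌([C(T,b)]⌞𝐁(0,1)) ≤ c(2p) · Σ_Z |k_Z| n(Z, b)` (lower
  semicontinuity of mass under the weak convergence `D_r → [C(T,b)]` and
  `HolomorphicChain.tendsto_mass_blowUp`).

Theorems only; no new definitions, no named facts.

## References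

* H. Federer, *Geometric Measure Theory*, Springer 1969, 4.1.7, 4.3.16–4.3.18 [Federer1969].
* R. Harvey, *Holomorphic chains and their boundaries*, PSPUM XXX.1 (1977), §1.10, Thm. 1.31
  [Harvey1977].
-/

noncomputable section

open scoped Manifold Topology ENNReal NNReal InnerProductSpace ContDiff Distributions
open Set Filter MeasureTheory Metric Function Module TopologicalSpace

namespace Literature.Geometry.Kaehler

open Literature.Geometry.GeometricMeasureTheory

-- Nested operator-norm instances on (duals of) `V [⋀^Fin n]→L[ℝ] ℝ`.
set_option maxSynthPendingDepth 2

universe u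

variable {V : Type u} [NormedAddCommGroup V] [InnerProductSpace ℂ V] [FiniteDimensional ℂ V]

namespace HolomorphicChain

variable [MeasurableSpace V] [BorelSpace V]

/-! ### `[C] ⌞ 𝐁(0,1)` for a chain `C` on `V` -/

section ToCurrentIn

variable {p : ℕ} (C : HolomorphicChain 𝓘(ℂ, V) (⊤ : Opens V) p)

/-- **`[C] ⌞ 𝐁(0,1)` is the restriction of `[C]` to the unit ball.** [cite: Federer1969, 4.1.7] -/
theorem toCurrentIn_unitBall_eq_comp :
    C.toCurrentIn (unitBall V) = C.toCurrent.comp (TestFunction.monoCLM ℝ) := by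
  letI : InnerProductSpace ℝ V := InnerProductSpace.complexToReal
  have hdata := Harvey1977_isRectifiableData_toCurrent_holds V (⊤ : Opens V) p C
  rw [toCurrentIn, toCurrent_def]
  exact currentOfIntegration_eq_comp_monoCLM le_top hdata.2.2.2.1

/-- `[C]⌞𝐁(0,1) (ψ) = [C](ψ̃)`, `ψ̃` the extension of `ψ` by zero. [cite: Federer1969, 4.1.7] -/
theorem toCurrentIn_unitBall_apply (ψ : TestForm (unitBall V) (2 * p)) :
    C.toCurrentIn (unitBall V) ψ = C.toCurrent (TestFunction.monoCLM ℝ ψ) := by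
  rw [toCurrentIn_unitBall_eq_comp]; rfl

/-- The data of `C` cut down to the unit ball are admissible rectifiable data on the unit ball.
[cite: Federer1969, 4.1.28] -/
theorem isRectifiableData_carrier_inter_unitBall :
    letI : InnerProductSpace ℝ V := InnerProductSpace.complexToReal
    IsRectifiableData (unitBall V) (2 * p) (C.carrier ∩ ball (0 : V) 1) C.density
      C.orientationFrame := by
  letI : InnerProductSpace ℝ V := InnerProductSpace.complexToReal
  exact (Harvey1977_isRectifiableData_toCurrent_holds V (⊤ : Opens V) p C).inter_of_le
    (Ω' := unitBall V) le_top

/-- **`[C] ⌞ 𝐁(0,1) = [carrier C ∩ 𝐁(0,1), θ_C, ξ_C]`** on the unit ball. [cite: Federer1969, 4.1.7] -/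
theorem toCurrentIn_unitBall_eq_inter :
    C.toCurrentIn (unitBall V) = currentOfIntegration (C.carrier ∩ ball (0 : V) 1) C.density
      C.orientationFrame := by
  letI : InnerProductSpace ℝ V := InnerProductSpace.complexToReal
  have hdata := Harvey1977_isRectifiableData_toCurrent_holds V (⊤ : Opens V) p C
  rw [toCurrentIn]
  exact (currentOfIntegration_inter_eq_of_le (Ω' := unitBall V) hdata.1 le_top hdata.2.2.2.1).symm

/-- `[C] ⌞ 𝐁(0,1)` is locally rectifiable on the unit ball. [cite: Federer1969, 4.1.28] -/
theorem isLocallyRectifiable_toCurrentIn_unitBall :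
    letI : InnerProductSpace ℝ V := InnerProductSpace.complexToReal
    (C.toCurrentIn (unitBall V)).IsLocallyRectifiable := by
  letI : InnerProductSpace ℝ V := InnerProductSpace.complexToReal
  exact ⟨_, _, _, C.isRectifiableData_carrier_inter_unitBall, C.toCurrentIn_unitBall_eq_inter⟩

/-- **Mass bound**: `𝐌([C]⌞𝐁(0,1)) ≤ ∫_{carrier C ∩ 𝐁(0,1)} |θ_C| d𝓗^{2p}`. [cite: Federer1969, 4.1.28] -/
theorem mass_toCurrentIn_unitBall_le :
    (C.toCurrentIn (unitBall V)).mass ≤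
      ∫⁻ x in C.carrier ∩ ball (0 : V) 1, ‖(C.density x : ℝ)‖ₑ ∂(μHE[2 * p] : Measure V) := by
  letI : InnerProductSpace ℝ V := InnerProductSpace.complexToReal
  rw [toCurrentIn_unitBall_eq_inter]
  exact C.isRectifiableData_carrier_inter_unitBall.mass_le

/-- **`[C]⌞𝐁(0,1)` has finite mass** (Lelong's bound `‖[C]‖(𝐁(0,1)) ≤ Const`).
[cite: Harvey1977, §1.10] -/
theorem mass_toCurrentIn_unitBall_ne_top : (C.toCurrentIn (unitBall V)).mass ≠ ⊤ := by
  letI : InnerProductSpace ℝ V := InnerProductSpace.complexToReal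
  obtain ⟨Cc, hCctop, hCc⟩ := C.exists_lintegral_density_ball_le' (b := (0 : V)) (R₁ := 1) one_pos
    (by simp)
  have h1 := hCc 0 (mem_closedBall_self zero_le_one) 1 one_pos le_rfl
  exact ne_top_of_le_ne_top (ENNReal.mul_ne_top hCctop ENNReal.ofReal_ne_top)
    (C.mass_toCurrentIn_unitBall_le.trans h1)

end ToCurrentIn

/-- **`[C]⌞𝐁(0,1)` is a cycle on the unit ball** (`∂[C] = 0` on `V`, and restriction commutes
with `∂`). [cite: Federer1969, 4.1.7; Harvey1977, Thm. 1.31] -/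
theorem boundary_toCurrentIn_unitBall_eq_zero {q : ℕ} (C : HolomorphicChain 𝓘(ℂ, V) (⊤ : Opens V) (q + 1)) :
    Current.boundary (C.toCurrentIn (unitBall V) : Current (unitBall V) (2 * q + 1 + 1)) = 0 := by
  letI : InnerProductSpace ℝ V := InnerProductSpace.complexToReal
  have hdata := Harvey1977_isRectifiableData_toCurrent_holds V (⊤ : Opens V) (q + 1) C
  have h0 : C.boundary = 0 := Harvey1977_boundary_toCurrent_eq_zero_holds V (⊤ : Opens V) q C
  exact currentOfIntegration_boundary_eq_zero_of_le (Ω' := unitBall V) le_top hdata.2.2.2.1 h0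

/-! ### Weak King in the vocabulary of `King1971_tangentCone` -/

section Weak

variable {Ω : Opens V} {q : ℕ}

/-- **King's theorem, weak form, in the vocabulary of the named fact**
`Literature.Geometry.Kaehler.King1971_tangentCone`: for a holomorphic `p`-chain `T` (`p = q + 1`)
with support of pure dimension `p` and `b ∈ Ω`, the defect currents
`D_r − [C(T,b)] ⌞ 𝐁(0,1)` converge weakly to `0` on the unit ball as `r → 0⁺`.
[cite: Harvey1977, Thm. 1.31; Federer1969, 4.3.18] -/
theorem tendsto_blowUp_sub_toCurrentIn_apply (T : HolomorphicChain 𝓘(ℂ, V) Ω (q + 1))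
    (hA : HasPureDim 𝓘(ℂ, V) T.support (q + 1)) {b : V} (hb : b ∈ (Ω : Set V))
    (ψ : TestForm (unitBall V) (2 * (q + 1))) :
    Tendsto (fun r => (T.blowUp b r - (tangentConeChain T hA hb).toCurrentIn (unitBall V)) ψ)
      (𝓝[>] (0 : ℝ)) (𝓝 0) := by
  have h := T.tendsto_blowUp_apply hA hb ψ
  rw [← toCurrentIn_unitBall_apply] at h
  have h2 := h.sub_const ((tangentConeChain T hA hb).toCurrentIn (unitBall V) ψ)
  rw [sub_self] at h2
  exact h2

/-- **Weak tangent cones of holomorphic chains, unconditionally, in the vocabulary of the named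
fact**: for every holomorphic `p`-chain `T` (`p = q + 1`) and `b ∈ Ω` there is a holomorphic
`p`-chain `C` on `V` with conic support such that `D_r − [C] ⌞ 𝐁(0,1) → 0` weakly on the unit ball
as `r → 0⁺`. [cite: Harvey1977, Thm. 1.31; Federer1969, 4.3.18] -/
theorem exists_conic_tendsto_blowUp_sub_toCurrentIn_apply (T : HolomorphicChain 𝓘(ℂ, V) Ω (q + 1))
    {b : V} (hb : b ∈ (Ω : Set V)) :
    ∃ C : HolomorphicChain 𝓘(ℂ, V) (⊤ : Opens V) (q + 1),
      (∀ x ∈ C.support, ∀ c : ℂ, (⟨c • (x : V), trivial⟩ : (⊤ : Opens V)) ∈ C.support) ∧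
      ∀ ψ : TestForm (unitBall V) (2 * (q + 1)),
        Tendsto (fun r => (T.blowUp b r - C.toCurrentIn (unitBall V)) ψ) (𝓝[>] (0 : ℝ)) (𝓝 0) := by
  obtain ⟨C, hcone, hC⟩ := T.exists_conic_tendsto_blowUp_apply hb
  refine ⟨C, hcone, fun ψ => ?_⟩
  have h := hC ψ
  rw [← toCurrentIn_unitBall_apply] at h
  have h2 := h.sub_const (C.toCurrentIn (unitBall V) ψ)
  rw [sub_self] at h2
  exact h2

/-- **The defect currents are cycles on the unit ball**: `∂(D_r − [C]⌞𝐁(0,1)) = 0` for `0 < r`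
with `B(b, r) ⊆ Ω` and any holomorphic `p`-chain `C` on `V`. [cite: Federer1969, 4.1.7, 4.3.16] -/
theorem boundary_blowUp_sub_toCurrentIn_eq_zero (T : HolomorphicChain 𝓘(ℂ, V) Ω (q + 1))
    (C : HolomorphicChain 𝓘(ℂ, V) (⊤ : Opens V) (q + 1)) {b : V} {r : ℝ} (hr : 0 < r)
    (hball : ball b r ⊆ (Ω : Set V)) :
    Current.boundary ((T.blowUp b r - C.toCurrentIn (unitBall V) :
      Current (unitBall V) (2 * q + 1 + 1))) = 0 := by
  rw [sub_eq_add_neg, Current.boundary_add, Current.boundary_neg,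
    T.boundary_blowUp_eq_zero' Harvey1977_isRectifiableData_toCurrent_holds
      Harvey1977_boundary_toCurrent_eq_zero_holds hr hball,
    C.boundary_toCurrentIn_unitBall_eq_zero, neg_zero, add_zero]

/-- **The defect currents have uniformly bounded mass**: there is `M < ∞` with
`𝐌(D_r − [C]⌞𝐁(0,1)) ≤ M` for all small `r > 0` (Lelong's bounds for the blow-ups,
`exists_mass_blowUp_le'`, and for `[C]`). [cite: Harvey1977, §1.10; Federer1969, 4.3.16] -/
theorem exists_mass_blowUp_sub_toCurrentIn_le (T : HolomorphicChain 𝓘(ℂ, V) Ω (q + 1))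
    (C : HolomorphicChain 𝓘(ℂ, V) (⊤ : Opens V) (q + 1)) {b : V} (hb : b ∈ (Ω : Set V)) :
    ∃ M : ℝ≥0∞, M ≠ ⊤ ∧ ∀ᶠ r in 𝓝[>] (0 : ℝ),
      (T.blowUp b r - C.toCurrentIn (unitBall V)).mass ≤ M := by
  obtain ⟨R, hR, hRΩ⟩ := Metric.isOpen_iff.1 Ω.isOpen b hb
  obtain ⟨M₀, hM₀top, hM₀⟩ := T.exists_mass_blowUp_le' (r₀ := R / 2) (R₀ := R) (half_pos hR)
    (half_lt_self hR) hRΩ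
  refine ⟨M₀ + (C.toCurrentIn (unitBall V)).mass,
    ENNReal.add_ne_top.2 ⟨hM₀top, C.mass_toCurrentIn_unitBall_ne_top⟩, ?_⟩
  filter_upwards [Ioo_mem_nhdsGT (half_pos hR)] with r hr
  calc (T.blowUp b r - C.toCurrentIn (unitBall V)).mass
      = (T.blowUp b r + -C.toCurrentIn (unitBall V)).mass := by rw [sub_eq_add_neg]
    _ ≤ (T.blowUp b r).mass + (-C.toCurrentIn (unitBall V)).mass := Current.mass_add_le _ _
    _ = (T.blowUp b r).mass + (C.toCurrentIn (unitBall V)).mass := by rw [Current.mass_neg]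
    _ ≤ M₀ + (C.toCurrentIn (unitBall V)).mass := by
        gcongr
        exact hM₀ r hr.1 hr.2.le

/-- **The mass of the tangent cone is at most the density of the chain**: for a holomorphic
`p`-chain `T` (`p = q + 1`) with support of pure dimension `p` and `b ∈ Ω`,
`𝐌([C(T,b)] ⌞ 𝐁(0,1)) ≤ c(2p) · Σ_Z |k_Z| n(Z, b)` — mass is weakly lower semicontinuous
(`Current.mass_le_liminf`) along `D_r → [C(T,b)]` (`tendsto_blowUp_apply`), and
`𝐌(D_r) → c(2p) Σ_Z |k_Z| n(Z,b)` (`tendsto_mass_blowUp`). [cite: Harvey1977, §1.9, Thm. 1.31; Federer1969, 4.3.16] -/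
theorem mass_toCurrentIn_tangentConeChain_le (T : HolomorphicChain 𝓘(ℂ, V) Ω (q + 1))
    (hA : HasPureDim 𝓘(ℂ, V) T.support (q + 1)) {b : V} (hb : b ∈ (Ω : Set V)) :
    ((tangentConeChain T hA hb).toCurrentIn (unitBall V)).mass ≤
      unitBallVolume (2 * (q + 1)) *
        ∑ᶠ Z : Set Ω, ENNReal.ofReal |(T.mult Z : ℝ)| * lelongNumber Z (q + 1) b := by
  haveI : (𝓝[>] (0 : ℝ)).NeBot := inferInstance
  have hweak : ∀ ψ : TestForm (unitBall V) (2 * (q + 1)),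
      Tendsto (fun r => T.blowUp b r ψ) (𝓝[>] (0 : ℝ))
        (𝓝 ((tangentConeChain T hA hb).toCurrentIn (unitBall V) ψ)) := fun ψ => by
    rw [toCurrentIn_unitBall_apply]
    exact T.tendsto_blowUp_apply hA hb ψ
  refine (Current.mass_le_liminf hweak).trans (le_of_eq (T.tendsto_mass_blowUp hb).liminf_eq)

end Weak

end HolomorphicChain

end Literature.Geometry.Kaehler
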